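import Summits.BirchSwinnertonDyer.BirchSwinnertonDyer.Theorems.GenusKolyvaginAtTwoTorsionCellSELNegTwistKernel
import Summits.BirchSwinnertonDyer.BirchSwinnertonDyer.Theorems.GenusKolyvaginAtTwoTorsionCellD0NegPrimeTwistClasses
import HarnessLib

/-!
# SEL (iso-class Selmer pair law), C1-I″: residues of an `S ∪ {q₀}`-supported unit at the other rows and at `p₀`

Crux R″ `RankOneTwoTorsionResidualAtTwo` (stmt-27478), LINE 49 «full_vertex», SUPPORT stub SEL
`IsoClassSelmerPairLawAtTwo`, the `C₁` half (LEAD memo `Cruxes/…/Lines/torsion_cell_full_vertex_SEL_C1_road_g36.md`,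
§2 (R4), the bits of the normalised extra class `z` that enter the explicit membership computation of part C1-J).
Setting: `S ∋ 2` a finite set of primes, `Q` an iso-class set of primes `≡ 3 (mod 4)` disjoint from `S` (`q ≡ q' (8)`,
`(qq'/ℓ) = 1` for odd `ℓ ∈ S`), `q₀ ∈ Q`, and a prime `p₀ ≡ 7 (mod 8)` outside `S ∪ Q` with `(−p₀/ℓ) = 1` for odd `ℓ ∈ S`.

* `exists_kernel_of_parityBit` — square-free kernel `[u] = [η ∏_{ℓ∈T} ℓ]`, `T ⊆ S'`, `η = sgn u`, of a unit `u` with even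
  valuation at every prime outside `S'` (tree `KramerTwoDescent.exists_eq_prod_mul_sq`).
* **`qrBit_of_supported_insert`** — for a unit `u` supported on `S ∪ {q₀}` with `qr_{q₀}(u) = 0`:
  `qr_j(u) = v_{q₀}(u) · (1 + [−q₀/j])` at every other `j ∈ Q` (iso-class constancy of the `S`-part), and
  `qr_{p₀}(u) = sgn u + v_{q₀}(u) · [−p₀/q₀]` (every positive `S`-unit is a square mod `p₀`; `[q₀/p₀] = [−p₀/q₀]`).

Everything is proved; no LINE 49 statement is restated; BSD is not advanced by this file alone.

## References

* [SilvermanAEC2009] J. H. Silverman, *The Arithmetic of Elliptic Curves*, 2nd ed., Prop. X.1.4.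
* [Kane2013SelmerTwists] D. M. Kane, Algebra Number Theory 7 (2013), §2.
* [HeathBrown1994SelmerCongruentII] D. R. Heath-Brown, Invent. Math. 118 (1994), §2.
-/

noncomputable section

open scoped Classical

namespace Summit.BirchSwinnertonDyer.BirchSwinnertonDyer.Theorems.GenusKolyvaginAtTwo.TorsionCellSEL

open WeierstrassCurve WeierstrassCurve.Affine WeierstrassCurve.Affine.Point
open Literature.NumberTheory.GaloisRepresentations Literature.NumberTheory.EllipticCurves Field
open Literature.NumberTheory.EllipticCurves.TwoDescentLocal
open Literature.NumberTheory.EllipticCurves.KramerTwoDescent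
open Summit.BirchSwinnertonDyer.BirchSwinnertonDyer.Theorems.GenusKolyvaginAtTwo.TorsionCellD0
open IsDedekindDomain NumberField Rat.HeightOneSpectrum

/-! ## Square-free kernel from parities -/

/-- **Square-free kernel of a unit with even valuations off `S'`**: `[u] = [η ∏_{ℓ∈T} ℓ]` with `T ⊆ S'` the primes of odd
valuation and `η = sgn u`. [cite: SilvermanAEC2009, Prop. X.1.4] -/
theorem exists_kernel_of_parityBit (S' : Finset ℕ) (hS' : ∀ ℓ ∈ S', ℓ.Prime) (u : ℚˣ)
    (hpar : ∀ ℓ : ℕ, (hℓ : ℓ.Prime) → ℓ ∉ S' → haveI : Fact ℓ.Prime := ⟨hℓ⟩; parityBit ℓ (u : ℚ) = 0) :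
    ∃ T ⊆ S', ∃ η : ℚ, (η = 1 ∨ η = -1) ∧ (η = 1 ↔ 0 < (u : ℚ)) ∧
      (∀ ℓ : ℕ, (hℓ : ℓ.Prime) → haveI : Fact ℓ.Prime := ⟨hℓ⟩; (ℓ ∈ T ↔ parityBit ℓ (u : ℚ) = 1)) ∧
      ∃ hg : η * ∏ ℓ ∈ T, (ℓ : ℚ) ≠ 0, (QuotientGroup.mk u : SqUnits ℚ) = QuotientGroup.mk (Units.mk0 _ hg) := by
  set T : Finset ℕ := S'.filter (fun ℓ => ∀ hℓ : ℓ.Prime, haveI : Fact ℓ.Prime := ⟨hℓ⟩; parityBit ℓ (u : ℚ) = 1) with hT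
  have hTS : T ⊆ S' := Finset.filter_subset _ _
  have hTp : ∀ ℓ ∈ T, ℓ.Prime := fun ℓ hℓ => hS' ℓ (hTS hℓ)
  have hmemT : ∀ ℓ : ℕ, (hℓ : ℓ.Prime) → haveI : Fact ℓ.Prime := ⟨hℓ⟩; (ℓ ∈ T ↔ parityBit ℓ (u : ℚ) = 1) := by
    intro ℓ hℓ
    haveI : Fact ℓ.Prime := ⟨hℓ⟩
    rw [hT, Finset.mem_filter]
    constructor
    · rintro ⟨-, h1⟩; exact h1 hℓ
    · intro h1
      refine ⟨?_, fun _ => h1⟩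
      by_contra hℓS
      have := hpar ℓ hℓ hℓS
      rw [this] at h1; exact zero_ne_one h1
  have habs : ∀ p : ℕ, padicValRat p |(u : ℚ)| = padicValRat p (u : ℚ) := by
    intro p; rcases abs_choice (u : ℚ) with h1 | h1 <;> rw [h1]; rw [padicValRat.neg]
  have hpos : (0 : ℚ) < |(u : ℚ)| := abs_pos.mpr u.ne_zero
  obtain ⟨r, hr⟩ := exists_eq_prod_mul_sq hTp hpos (fun p hp => by
    haveI : Fact p.Prime := ⟨hp⟩
    rw [habs, ← parityBit_eq_zero_iff, hmemT p hp]
    constructor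
    · intro h0 h1; rw [h0] at h1; exact zero_ne_one h1
    · intro h1; rcases (by decide : ∀ x : ZMod 2, x = 0 ∨ x = 1) (parityBit p (u : ℚ)) with h0 | h0
      · exact h0
      · exact absurd h0 h1)
  have hprod0 : ∏ ℓ ∈ T, (ℓ : ℚ) ≠ 0 := Finset.prod_ne_zero_iff.mpr fun ℓ hℓ => by exact_mod_cast (hTp ℓ hℓ).ne_zero
  have hr0 : r ≠ 0 := by
    intro h0; rw [h0, zero_pow two_ne_zero, mul_zero] at hr; exact hpos.ne' hr
  set η : ℚ := if (0 : ℚ) < u then 1 else -1 with hη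
  have hη1 : η = 1 ∨ η = -1 := by rw [hη]; split_ifs <;> simp
  have hη0 : η ≠ 0 := by rcases hη1 with h1 | h1 <;> rw [h1] <;> norm_num
  have hηpos : η = 1 ↔ 0 < (u : ℚ) := by
    rw [hη]; split_ifs with hlt
    · exact ⟨fun _ => hlt, fun _ => rfl⟩
    · exact ⟨fun h1 => absurd h1 (by norm_num), fun hlt' => absurd hlt' hlt⟩
  have hueq : (u : ℚ) = η * (∏ ℓ ∈ T, (ℓ : ℚ)) * r ^ 2 := by
    rw [hη]; split_ifs with hlt
    · rw [one_mul, ← hr, abs_of_pos hlt]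
    · have hneg : (u : ℚ) < 0 := lt_of_le_of_ne (not_lt.mp hlt) u.ne_zero
      rw [← neg_neg (u : ℚ), ← abs_of_neg hneg, hr]; ring
  refine ⟨T, hTS, η, hη1, hηpos, hmemT, mul_ne_zero hη0 hprod0, ?_⟩
  have key : (u : ℚ) * (r⁻¹) ^ 2 = η * ∏ ℓ ∈ T, (ℓ : ℚ) := by
    rw [hueq]; field_simp
  refine QuotientGroup.eq.mpr ⟨Units.mk0 (r⁻¹) (inv_ne_zero hr0), Units.ext ?_⟩
  rw [powMonoidHom_apply, Units.val_pow_eq_pow_val, Units.val_mk0, Units.val_mul, Units.val_inv_eq_inv_val,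
    Units.val_mk0, ← key, ← mul_assoc, inv_mul_cancel₀ u.ne_zero, one_mul]

/-! ## Residues of an `S ∪ {q₀}`-supported unit -/

variable (S Q : Finset ℕ) {q₀ p₀ : ℕ} [hq₀ : Fact q₀.Prime] [hp₀ : Fact p₀.Prime]

/-- **Residues of a unit supported on `S ∪ {q₀}` with `qr_{q₀}(u) = 0`**: at every other `j ∈ Q`,
`qr_j(u) = v_{q₀}(u)·(1 + [−q₀/j])`, and at `p₀`, `qr_{p₀}(u) = sgn u + v_{q₀}(u)·[−p₀/q₀]`.
[cite: Kane2013SelmerTwists, §2] [cite: HeathBrown1994SelmerCongruentII, §2] -/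
theorem qrBit_of_supported_insert (hS : ∀ ℓ ∈ S, ℓ.Prime) (hQ : ∀ q ∈ Q, q.Prime) (hQS : ∀ q ∈ Q, q ∉ S)
    (hQ4 : ∀ q ∈ Q, q % 4 = 3) (hiso8 : ∀ q ∈ Q, ∀ q' ∈ Q, q % 8 = q' % 8)
    (hisoS : ∀ q ∈ Q, ∀ q' ∈ Q, ∀ ℓ ∈ S, (hℓ : ℓ.Prime) → ℓ ≠ 2 → haveI : Fact ℓ.Prime := ⟨hℓ⟩;
      legendreSym ℓ ((q : ℤ) * q') = 1)
    (hq₀Q : q₀ ∈ Q) (hp₀S : p₀ ∉ S) (hp₀Q : p₀ ∉ Q) (hp8 : p₀ % 8 = 7)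
    (hsplitp : ∀ ℓ ∈ S, (hℓ : ℓ.Prime) → ℓ ≠ 2 → haveI : Fact ℓ.Prime := ⟨hℓ⟩; legendreSym ℓ (-(p₀ : ℤ)) = 1)
    (u : ℚˣ) (hsupp : ∀ ℓ : ℕ, (hℓ : ℓ.Prime) → ℓ ∉ S → ℓ ≠ q₀ → haveI : Fact ℓ.Prime := ⟨hℓ⟩; parityBit ℓ (u : ℚ) = 0)
    (hres : qrBit q₀ (u : ℚ) = 0) :
    (∀ j ∈ Q, j ≠ q₀ → (hj : j.Prime) → haveI : Fact j.Prime := ⟨hj⟩;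
      qrBit j (u : ℚ) = parityBit q₀ (u : ℚ) * (1 + (if jacobiSym (-(q₀ : ℤ)) j = -1 then (1 : ZMod 2) else 0))) ∧
    qrBit p₀ (u : ℚ) = signBit (u : ℚ) + parityBit q₀ (u : ℚ) * (if jacobiSym (-(p₀ : ℤ)) q₀ = -1 then (1 : ZMod 2) else 0) := by
  have hp4 : p₀ % 4 = 3 := by omega
  have hq₀p : q₀ ≠ p₀ := fun e => hp₀Q (e ▸ hq₀Q)
  have hS'p : ∀ ℓ ∈ insert q₀ S, ℓ.Prime := fun ℓ hℓ => by
    rcases Finset.mem_insert.mp hℓ with rfl | hℓ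
    · exact hq₀.out
    · exact hS ℓ hℓ
  obtain ⟨T, hTS', η, hη1, hηpos, hmemT, hg, hmk⟩ := exists_kernel_of_parityBit (insert q₀ S) hS'p u
    (fun ℓ hℓ hℓS' => hsupp ℓ hℓ (fun e => hℓS' (Finset.mem_insert_of_mem e)) (fun e => hℓS' (e ▸ Finset.mem_insert_self _ _)))
  have hη0 : η ≠ 0 := by rcases hη1 with h1 | h1 <;> rw [h1] <;> norm_num
  -- the `S`-part of the kernel
  set T₀ : Finset ℕ := T.erase q₀ with hT₀
  have hT₀S : T₀ ⊆ S := fun ℓ hℓ => by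
    rcases Finset.mem_insert.mp (hTS' (Finset.mem_of_mem_erase hℓ)) with e | e
    · exact absurd e (Finset.ne_of_mem_erase hℓ)
    · exact e
  have hT₀0 : ∏ ℓ ∈ T₀, (ℓ : ℚ) ≠ 0 := Finset.prod_ne_zero_iff.mpr fun ℓ hℓ => by exact_mod_cast (hS ℓ (hT₀S hℓ)).ne_zero
  have hker0 : η * ∏ ℓ ∈ T₀, (ℓ : ℚ) ≠ 0 := mul_ne_zero hη0 hT₀0
  have hq₀0 : (q₀ : ℚ) ≠ 0 := by exact_mod_cast hq₀.out.ne_zero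
  -- `η ∏_T = (q₀ if q₀ ∈ T) · η ∏_{T₀}`
  have hsplit : η * ∏ ℓ ∈ T, (ℓ : ℚ) = (if q₀ ∈ T then (q₀ : ℚ) else 1) * (η * ∏ ℓ ∈ T₀, (ℓ : ℚ)) := by
    by_cases hqT : q₀ ∈ T
    · rw [if_pos hqT, hT₀, ← Finset.mul_prod_erase T (fun ℓ => (ℓ : ℚ)) hqT]; ring
    · rw [if_neg hqT, one_mul, hT₀, Finset.erase_eq_of_notMem hqT]
  -- the indicator of `q₀ ∈ T` is the parity of `u` at `q₀`
  have hind : ∀ (x : ZMod 2), (if q₀ ∈ T then x else 0) = parityBit q₀ (u : ℚ) * x := by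
    intro x
    by_cases hqT : q₀ ∈ T
    · rw [if_pos hqT, (hmemT q₀ hq₀.out).mp hqT, one_mul]
    · rw [if_neg hqT]
      rcases (by decide : ∀ y : ZMod 2, y = 0 ∨ y = 1) (parityBit q₀ (u : ℚ)) with h0 | h1
      · rw [h0, zero_mul]
      · exact absurd ((hmemT q₀ hq₀.out).mpr h1) hqT
  -- the residue of the `S`-part at `q₀` vanishes
  have hres₀ : qrBit q₀ (η * ∏ ℓ ∈ T₀, (ℓ : ℚ)) = 0 := by
    have := hres
    rw [qrBit_eq_of_mk_eq q₀ hmk, Units.val_mk0, hsplit] at this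
    by_cases hqT : q₀ ∈ T
    · rwa [if_pos hqT, qrBit_natCast_mul] at this
    · rwa [if_neg hqT, one_mul] at this
  constructor
  · -- rows `j ≠ q₀`
    intro j hj hjq hjp
    haveI : Fact j.Prime := ⟨hjp⟩
    have hconst : qrBit j (η * ∏ ℓ ∈ T₀, (ℓ : ℚ)) = qrBit q₀ (η * ∏ ℓ ∈ T₀, (ℓ : ℚ)) :=
      qrBit_kernel_eq_of_isoClass S Q hS hQS hQ4 hiso8 hisoS hj hq₀Q hT₀S hη1
    rw [qrBit_eq_of_mk_eq j hmk, Units.val_mk0, hsplit, qrBit_mul j (by split_ifs; exacts [hq₀0, one_ne_zero]) hker0,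
      hconst, hres₀, add_zero, ← hind]
    by_cases hqT : q₀ ∈ T
    · rw [if_pos hqT, if_pos hqT, qrBit_natCast_prime_eq_one_add (hQ4 j hj) hq₀.out (Ne.symm hjq)]
    · rw [if_neg hqT, if_neg hqT, qrBit_one]
  · -- the residue at `p₀`
    have hsum : qrBit p₀ (η * ∏ ℓ ∈ T₀, (ℓ : ℚ)) = signBit (u : ℚ) := by
      rw [qrBit_mul p₀ hη0 hT₀0, qrBit_prod p₀ T₀ (fun ℓ => (ℓ : ℚ)) (fun ℓ hℓ => by exact_mod_cast (hS ℓ (hT₀S hℓ)).ne_zero)]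
      have hzero : ∑ ℓ ∈ T₀, qrBit p₀ ((ℓ : ℕ) : ℚ) = 0 := by
        refine Finset.sum_eq_zero fun ℓ hℓ => ?_
        have hℓS := hT₀S hℓ
        have hℓ := hS ℓ hℓS
        by_cases hℓ2 : ℓ = 2
        · subst hℓ2; exact_mod_cast qrBit_two_eq_zero (p := p₀) hp8
        · exact qrBit_prime_eq_zero_of_legendreSym (p := p₀) hp8 hℓ hℓ2 (fun e => hp₀S (e ▸ hℓS)) (hsplitp ℓ hℓS hℓ hℓ2)
      rw [hzero, add_zero]
      rcases hη1 with h1 | h1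
      · rw [h1, qrBit_one, (signBit_eq_zero_iff u.ne_zero).mpr (hηpos.mp h1)]
      · rw [h1, qrBit_neg_one_eq_one_of_emod_four hp4, signBit, if_pos]
        exact lt_of_le_of_ne (not_lt.mp fun hlt => by rw [hηpos.mpr hlt] at h1; norm_num at h1) u.ne_zero
    rw [qrBit_eq_of_mk_eq p₀ hmk, Units.val_mk0, hsplit, qrBit_mul p₀ (by split_ifs; exacts [hq₀0, one_ne_zero]) hker0,
      hsum, ← hind, add_comm]
    congr 1
    by_cases hqT : q₀ ∈ T
    · rw [if_pos hqT, if_pos hqT, qrBit_natCast_prime_eq_jacobiBit (hQ q₀ hq₀Q) hq₀p hp4 (hQ4 q₀ hq₀Q)]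
    · rw [if_neg hqT, if_neg hqT, qrBit_one]

end Summit.BirchSwinnertonDyer.BirchSwinnertonDyer.Theorems.GenusKolyvaginAtTwo.TorsionCellSEL

end
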